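import Summits.AtomisticToContinuum.Crystallization.Theorems.OverbindingBudgetTwoShellTransfer

/-!
# OverbindingBudget — B₁ᵃ⁺ `LimitChargeFreeBall` PROVED and the RDEF cone with the local two-shell rigidity piece (lens-4 g28, part IXb)

Helper file (`--supports stmt-AtomisticToContinuum-31280`).  `limitChargeFreeBall_holds (T₀ D) : LimitChargeFreeBall T₀ D`: in a clean
texture with sparse charge every site `q` is, for every `ε > 0`, `ε`-matched on `B(0, 3)` to a `7`-deep chunk site whose whole `3`-ball of
chunk sites is `1/100`-charge-free.  Proof = the grid argument of `limitChargeFree_holds` at spacing `s = 2G + 2‖q‖ + 18`: the `m³`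
re-rooted copies of the `(‖q‖+5)`-patch are `> 14` apart in some coordinate, so charged sites within `3` of distinct copies are distinct;
were every copy`s `3`-ball charged somewhere, `chargedCount ≥ m³ ≥ ℓ³/(8s³)` cofinally — `DenseCharge`, contradicting `SparseCharge`.
With the proved seams of part IXa this gives the RDEF cone whose two-shell bridge input is the single finite local statement
`LocalTwoShellRigidity (1/250) 10` (`rdef_of_grossU_doorPeriodic_local`).
-/

namespace Summit.AtomisticToContinuum.Crystallization.Theorems.OverbindingBudgetLimitChargeFreeBall

open scoped Classical
open Literature.MathematicalPhysics.StatisticalMechanics (UniformlyDiscrete Match)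
open Literature.Geometry.DiscreteGeometry (IsTwoShellGoodSet IsChargeFree)
open Summit.AtomisticToContinuum.Crystallization.Theses.OverbindingBudget (RobustDefectLimitWindows)
open Summit.AtomisticToContinuum.Crystallization.Theses.PricedLinkCensus (ChargedEnergyGap)
open Summit.AtomisticToContinuum.Crystallization.Theorems.OverbindingBudgetGradedBareness (CleanlessExcessT)
open Summit.AtomisticToContinuum.Crystallization.Theorems.OverbindingBudgetCoherentCut (CoherentResidual)
open Summit.AtomisticToContinuum.Crystallization.Theorems.OverbindingBudgetUniformCutStatements (GrossCleanBallsU)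
open Summit.AtomisticToContinuum.Crystallization.Theorems.OverbindingBudgetExcessInstability (finite_inter_cube)
open Summit.AtomisticToContinuum.Crystallization.Theorems.OverbindingBudgetEdgeRelaxationStatements (CleanClass)
open Summit.AtomisticToContinuum.Crystallization.Theorems.OverbindingBudgetElasticSplitStatements (chargedCount DenseCharge SparseCharge)
open Summit.AtomisticToContinuum.Crystallization.Theorems.OverbindingBudgetElasticSplitDilation (enum enum_injective)
open Summit.AtomisticToContinuum.Crystallization.Theorems.OverbindingBudgetElasticSplitScale (HasCompressedScale CompressedVirialLaw)
open Summit.AtomisticToContinuum.Crystallization.Theorems.OverbindingBudgetElasticSplitPeriodic (PeriodicStrainedCubes)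
open Summit.AtomisticToContinuum.Crystallization.Theorems.OverbindingBudgetElasticSplitDoorBridge (CleanCharted rdef_of_grossU_doorPeriodic)
open Summit.AtomisticToContinuum.Crystallization.Theorems.ChartedPlanarOrderDoorLayered (DoorPeriodic)
open Summit.AtomisticToContinuum.Crystallization.Theorems.OverbindingBudgetCleanTwoShellCut (range_enum match_reroot)
open Summit.AtomisticToContinuum.Crystallization.Theorems.OverbindingBudgetTwoShellTransfer (ChargeFreeBallNear LimitChargeFreeBall
  LocalTwoShellRigidity cleanTwoShell_of_ballPieces chargeFreeBallRigidity_of_local)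

/-! ## §1 B₁ᵃ⁺ proved -/

set_option maxHeartbeats 4000000 in
/-- **`LimitChargeFreeBall T₀ D` holds for all parameters.** [this file] -/
theorem limitChargeFreeBall_holds (T₀ D : ℝ) : LimitChargeFreeBall T₀ D := by
  intro Y hY hsc q hq ε hε
  by_contra hno
  have hUD : UniformlyDiscrete Y := hY.1
  have hcov : ∀ z : EuclideanSpace ℝ (Fin 3), ∃ w ∈ Y, dist z w ≤ 9 / 10 := hY.2.2.2.1
  -- the precision and radius of the recurrence
  set ε' : ℝ := min (ε / 2) (1 / 2) with hε'def
  have hε'pos : 0 < ε' := lt_min (by linarith) (by norm_num)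
  have hε'le : ε' ≤ 1 / 2 := min_le_right _ _
  have hε'ε : 2 * ε' ≤ ε := by have := min_le_left (ε / 2) (1 / 2); linarith
  set R : ℝ := ‖q‖ + 5 with hRdef
  obtain ⟨G, hG⟩ := hY.2.2.1 R ε' hε'pos
  set G₀ : ℝ := max G 0 with hG₀def
  have hG₀ : 0 ≤ G₀ := le_max_right _ _
  have hGG₀ : G ≤ G₀ := le_max_left _ _
  have hq0 : 0 ≤ ‖q‖ := norm_nonneg _
  -- the spacing and the density
  set s : ℝ := 2 * G₀ + 2 * ‖q‖ + 18 with hsdef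
  have hs : 0 < s := by positivity
  set ρ : ℝ := 1 / (8 * s ^ 3) with hρdef
  have hρ : 0 < ρ := by positivity
  apply hsc ρ hρ
  -- DenseCharge ρ Y
  intro ℓ₀
  set m : ℕ := ⌈ℓ₀ / s⌉₊ + 1 with hmdef
  have hm1 : (1 : ℝ) ≤ m := by
    have : (1 : ℕ) ≤ m := Nat.le_add_left 1 _
    exact_mod_cast this
  set ℓ : ℝ := s * ((m : ℝ) + 1) with hℓdef
  have hℓ₀ : ℓ₀ ≤ ℓ := by
    have h1 : ℓ₀ / s ≤ ⌈ℓ₀ / s⌉₊ := Nat.le_ceil _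
    have h2 : (⌈ℓ₀ / s⌉₊ : ℝ) ≤ m := by
      have : ⌈ℓ₀ / s⌉₊ ≤ m := Nat.le_succ _
      exact_mod_cast this
    have h3 : ℓ₀ / s ≤ (m : ℝ) + 1 := by linarith
    have h4 : ℓ₀ ≤ s * (ℓ₀ / s) := by rw [mul_div_cancel₀ _ hs.ne']
    calc ℓ₀ ≤ s * (ℓ₀ / s) := h4
      _ ≤ s * ((m : ℝ) + 1) := mul_le_mul_of_nonneg_left h3 hs.le
  have hℓpos : 0 < ℓ := by positivity
  -- the chunk and its enumeration
  set c : EuclideanSpace ℝ (Fin 3) := 0 with hcdef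
  have hci : ∀ i : Fin 3, c i = 0 := fun i => rfl
  have hfin := finite_inter_cube hUD c hℓpos.le
  set F : Finset (EuclideanSpace ℝ (Fin 3)) := hfin.toFinset with hFdef
  have hF : (↑F : Set (EuclideanSpace ℝ (Fin 3))) = Y ∩ {z | ∀ i : Fin 3, c i ≤ z i ∧ z i < c i + ℓ} := hfin.coe_toFinset
  refine ⟨ℓ, hℓ₀, c, F.card, enum F, enum_injective F, by rw [range_enum, hF], ?_⟩
  -- the grid, its nearby sites, their re-rootings
  set z : (Fin 3 → Fin m) → EuclideanSpace ℝ (Fin 3) :=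
    fun k => WithLp.toLp 2 (fun i => (G₀ + ‖q‖ + 9) + s * ((k i : ℕ) : ℝ)) with hzdef
  have hzi : ∀ k i, z k i = (G₀ + ‖q‖ + 9) + s * ((k i : ℕ) : ℝ) := by intro k i; simp [hzdef]
  choose w hwY hwd using fun k => hcov (z k)
  choose g hgY hgd hM using fun k => hG (w k) (hwY k)
  have key : ∀ k, ∃ p ∈ Y, dist (p - g k) q ≤ ε' := by
    intro k
    have hqR : dist q 0 ≤ R := by rw [dist_zero_right]; linarith
    obtain ⟨a, ⟨p, hp, rfl⟩, hd⟩ := (hM k).1 q hq hqR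
    exact ⟨p, hp, hd⟩
  choose p hpY hpd using key
  -- coordinates of the re-rooted sites relative to the grid
  have hpz : ∀ k, dist (p k) (z k) ≤ G₀ + ‖q‖ + 2 := by
    intro k
    have h1 : dist (p k) (g k + q) ≤ ε' := by
      have e : dist (p k) (g k + q) = dist (p k - g k) q := by rw [dist_eq_norm, dist_eq_norm]; congr 1; abel
      rw [e]; exact hpd k
    have h2 : dist (g k + q) (g k) = ‖q‖ := by rw [dist_eq_norm]; simp
    have h3 : dist (g k) (w k) ≤ G₀ := (hgd k).trans hGG₀
    have h4 : dist (w k) (z k) ≤ 9 / 10 := by rw [dist_comm]; exact hwd k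
    calc dist (p k) (z k) ≤ dist (p k) (w k) + dist (w k) (z k) := dist_triangle _ _ _
      _ ≤ dist (p k) (g k + q) + dist (g k + q) (g k) + dist (g k) (w k) + dist (w k) (z k) := by
          linarith [dist_triangle4 (p k) (g k + q) (g k) (w k)]
      _ ≤ ε' + ‖q‖ + G₀ + 9 / 10 := by rw [h2]; linarith
      _ ≤ G₀ + ‖q‖ + 2 := by linarith
  have hco : ∀ k i, -(G₀ + ‖q‖ + 2) ≤ p k i - z k i ∧ p k i - z k i ≤ G₀ + ‖q‖ + 2 := by
    intro k i
    have h : dist (p k i) (z k i) ≤ G₀ + ‖q‖ + 2 := (PiLp.dist_apply_le (p k) (z k) i).trans (hpz k)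
    rw [Real.dist_eq, abs_le] at h
    exact h
  have hkm : ∀ (k : Fin 3 → Fin m) (i : Fin 3), ((k i : ℕ) : ℝ) + 1 ≤ m := fun k i => by
    have h : (k i : ℕ) + 1 ≤ m := (k i).isLt
    exact_mod_cast h
  -- deepness
  have hdeep : ∀ k i, c i + 7 ≤ p k i ∧ p k i + 7 ≤ c i + ℓ := by
    intro k i
    have h1 := hco k i
    have h2 := hzi k i
    have h3 := hkm k i
    have h0 : (0 : ℝ) ≤ ((k i : ℕ) : ℝ) := Nat.cast_nonneg _
    have hsk : 0 ≤ s * ((k i : ℕ) : ℝ) := mul_nonneg hs.le h0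
    have h4 : s * (((k i : ℕ) : ℝ) + 1) ≤ s * (m : ℝ) := mul_le_mul_of_nonneg_left h3 hs.le
    rw [hci]
    constructor
    · linarith [h1.1, h2, hsk]
    · linarith [h1.2, h2, h4, hℓdef, hsdef, hs.le]
  have hcube : ∀ k, p k ∈ Y ∩ {x | ∀ i : Fin 3, c i ≤ x i ∧ x i < c i + ℓ} := fun k =>
    ⟨hpY k, fun i => ⟨by linarith [(hdeep k i).1], by linarith [(hdeep k i).2]⟩⟩
  -- coordinates of distinct grid copies differ by at least `14` somewhere
  have hfar : ∀ k k', k ≠ k' → ∃ i, 14 ≤ |p k i - p k' i| := by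
    intro k k' hne
    obtain ⟨i, hi⟩ := Function.ne_iff.1 hne
    have hi' : (k i : ℕ) ≠ (k' i : ℕ) := fun h => hi (Fin.ext h)
    refine ⟨i, ?_⟩
    have h1 := hco k i
    have h2 := hco k' i
    have hd : z k i - z k' i = s * (((k i : ℕ) : ℝ) - ((k' i : ℕ) : ℝ)) := by rw [hzi, hzi]; ring
    have hs14 : 2 * (G₀ + ‖q‖ + 2) + 14 ≤ s := by rw [hsdef]; linarith
    rcases lt_or_gt_of_ne hi' with hlt | hlt
    · have h : ((k i : ℕ) : ℝ) + 1 ≤ ((k' i : ℕ) : ℝ) := by exact_mod_cast hlt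
      have hz : z k i - z k' i ≤ -s := by rw [hd]; nlinarith
      rw [abs_sub_comm, le_abs]; left; linarith [h1.2, h2.1]
    · have h : ((k' i : ℕ) : ℝ) + 1 ≤ ((k i : ℕ) : ℝ) := by exact_mod_cast hlt
      have hz : s ≤ z k i - z k' i := by rw [hd]; nlinarith
      rw [le_abs]; left; linarith [h1.1, h2.2]
  -- each p k is an enumerated site, and some chunk site within 3 of it is CHARGED (else `ChargeFreeBallNear Y q ε`)
  have hidx : ∀ k, ∃ i : Fin F.card, enum F i = p k := by
    intro k
    have h : p k ∈ Set.range (enum F) := by rw [range_enum, hF]; exact hcube k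
    exact h
  choose idx hidx using hidx
  have hcharged : ∀ k, ∃ u : Fin F.card, dist (enum F u) (p k) ≤ 3 ∧ ¬ IsChargeFree (1 / 100 : ℝ) (enum F) u := by
    intro k
    by_contra hall
    push Not at hall
    apply hno
    refine ⟨c, ℓ, F.card, enum F, idx k, enum_injective F, by rw [range_enum, hF], ?_, ?_, ?_⟩
    · intro j; rw [hidx k]; exact hdeep k j
    · intro i' hi'
      rw [hidx k] at hi'
      exact hall i' hi'
    · rw [hidx k]
      have hRε : ‖q‖ + 3 + ε' ≤ R := by rw [hRdef]; linarith
      exact (match_reroot (hM k) (hpd k) hε'pos.le hRε).mono hε'ε le_rfl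
  choose u hud huc using hcharged
  -- counting: m³ charged sites, and ρ ℓ³ ≤ m³
  set f : (Fin 3 → Fin m) → {i : Fin F.card // ¬ IsChargeFree (1 / 100 : ℝ) (enum F) i} := fun k => ⟨u k, huc k⟩ with hfdef
  have hfinj : Function.Injective f := by
    intro k k' hkk'
    have h1 : u k = u k' := by
      have := congrArg Subtype.val hkk'
      simpa [hfdef] using this
    by_contra hne
    obtain ⟨i, hi⟩ := hfar k k' hne
    have h2 : dist (p k) (p k') ≤ 6 := by
      have t1 := hud k
      have t2 := hud k'
      rw [h1] at t1
      rw [dist_comm] at t1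
      linarith [dist_triangle (p k) (enum F (u k')) (p k')]
    have h3 : |p k i - p k' i| ≤ 6 := by
      have := (PiLp.dist_apply_le (p k) (p k') i).trans h2
      rwa [Real.dist_eq] at this
    linarith
  have hcard : Nat.card (Fin 3 → Fin m) ≤ chargedCount (enum F) := by
    unfold chargedCount
    exact Nat.card_le_card_of_injective f hfinj
  have hu : Nat.card (Fin 3 → Fin m) = m ^ 3 := by
    rw [Nat.card_eq_fintype_card, Fintype.card_fun, Fintype.card_fin, Fintype.card_fin]
  rw [hu] at hcard
  have hcardR : ((m : ℝ)) ^ 3 ≤ (chargedCount (enum F) : ℝ) := by exact_mod_cast hcard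
  have hρℓ : ρ * ℓ ^ 3 ≤ (m : ℝ) ^ 3 := by
    rw [hρdef, hℓdef]
    have hs3 : 0 < s ^ 3 := by positivity
    have e : 1 / (8 * s ^ 3) * (s * ((m : ℝ) + 1)) ^ 3 = ((m : ℝ) + 1) ^ 3 / 8 := by
      field_simp
    rw [e]
    have hm2 : (m : ℝ) + 1 ≤ 2 * m := by linarith
    have h0 : (0 : ℝ) ≤ (m : ℝ) + 1 := by linarith
    have h8 : ((m : ℝ) + 1) ^ 3 ≤ (2 * m) ^ 3 := by
      exact pow_le_pow_left₀ h0 hm2 3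
    nlinarith [h8]
  exact hρℓ.trans hcardR

/-! ## §2 The cone with the local two-shell rigidity piece -/

/-- **RDEF cone with the finite local rigidity statement** (every `Λ`): `GrossCleanBallsU (1/250) 10 → ChargedEnergyGap →
CompressedVirialLaw (1/250) 10 → LocalTwoShellRigidity (1/250) 10 → CleanCharted (1/250) 10 → DoorPeriodic Λ →
PeriodicStrainedCubes Λ (1/250) 10 → CleanlessExcessT → CoherentResidual 10 → RobustDefectLimitWindows`. [this file] -/
theorem rdef_of_grossU_doorPeriodic_local (Λ : ℝ) (hG : GrossCleanBallsU (1 / 250) 10) (hCEG : ChargedEnergyGap)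
    (hC : CompressedVirialLaw (1 / 250) 10) (hL : LocalTwoShellRigidity (1 / 250) 10) (h₂ : CleanCharted (1 / 250) 10) (hD : DoorPeriodic Λ)
    (hE : PeriodicStrainedCubes Λ (1 / 250) 10) (hCE : CleanlessExcessT) (hR : CoherentResidual 10) : RobustDefectLimitWindows :=
  rdef_of_grossU_doorPeriodic Λ hG hCEG hC
    (cleanTwoShell_of_ballPieces (limitChargeFreeBall_holds (1 / 250) 10) (chargeFreeBallRigidity_of_local (by norm_num) hL)) h₂ hD hE hCE hR

end Summit.AtomisticToContinuum.Crystallization.Theorems.OverbindingBudgetLimitChargeFreeBall
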